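import Mathlib
import Summits.Ventures.PercRepro2.RootCutSumsLinear

/-!
# The ratio sums of `btw` and `FMfun` across the root pair
(blind cell PercRepro2, night-1 g33; proofs/NIGHT1-G33.md, the root-shield identity; the identity is
RootCutShield.lean)

Setting of RootCutSums / RootCutSumsLinear: the roots separate `VR` from `VS`, `x ∈ VS`, the masses on a pair `W = T ∪ W_R`
factor into an `S`-factor (depending on `T`) and an `R`-factor (depending on `W_R`).  The ratio terms
`Sb·SFg(γ)/m_W` and `Su_b·Su_o/m_W` are the product of the `S`-factor of one mark and the `R`-factor of
the other (the factors `μ(T)·ρ_T(W_R)` of `m_W` cancel; on null fibres both sides vanish since the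
weights are nonnegative), so after summing the `R`-factors over `W_R`:
* `o` on the `R`-side (`sum_term_oR`, `sum_SFg_oR`, `sum_termA_oR`): the `o`-data enters through the
  constants `κ_{a₁}(o) ± κ_{a₂}(o)` and `ρ` only — `Φ_γ(T) = (κ₁ − κ₂) + s3(T)(γ ρ − (κ₁ + κ₂))`;
* `b` on the `R`-side (`sum_term_bR`, `sum_SFg_oS`, `sum_termA_bR`): the `b`-data enters through
  `κ_{a₁}(b) ± κ_{a₂}(b)` only — `ψ_γ(T) = (μ₁^o − μ₂^o)(T) + s3(T)(γ μ(T) − (μ₁^o + μ₂^o)(T))`.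
Standard axioms.
-/

namespace Summit.Ventures.PercRepro2

open UnionCluster CovForm CutV

namespace CovForm

namespace A3Fibre

namespace RootShield

section Ratio

variable {V : Type*} {E : Type*} [Fintype V] [DecidableEq V] [Fintype E] [DecidableEq E]
  {R : Type*} [Field R] [LinearOrder R] [IsStrictOrderedRing R] {ends : E → Sym2 V} {a₁ a₂ : V}
  {VR VS : Finset V} {ER ES : Set E} [DecidablePred (· ∈ ER)] [DecidablePred (· ∈ ES)] {p : E → R}

/-! ## Null factors -/

omit [Fintype V] [DecidableEq V] [DecidablePred (· ∈ ER)] in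
/-- `μ_r^y(T) = 0` when `μ(T) = 0`. -/
lemma muSc_eq_zero (hp : IsProbVec p) {x : V} {T : Finset V}
    (h0 : muS p ends a₁ a₂ ES x T = 0) (r y : V) : muSc p ends a₁ a₂ ES x r y T = 0 := by
  unfold muS at h0
  unfold muSc
  have key := prob_mono hp (show sideEvent ES (clusterEvent ends x (↑T : Set V) ∩
      (avoidAll ends a₂ {a₁} ∩ connEvent ends r y)) ⊆
      sideEvent ES (clusterEvent ends x (↑T : Set V) ∩ avoidAll ends a₂ {a₁}) from
    fun _ hω => ⟨hω.1, hω.2.1⟩)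
  rw [h0] at key
  exact le_antisymm key (prob_nonneg hp _)

omit [Fintype V] [DecidablePred (· ∈ ES)] in
/-- `ρ_T^{r,y}(W_R) = 0` when `ρ_T(W_R) = 0`. -/
lemma rhoTc_eq_zero (hp : IsProbVec p) {T W_R : Finset V}
    (h0 : rhoT p ends a₁ a₂ ER T W_R = 0) (r y : V) : rhoTc p ends a₁ a₂ ER T W_R r y = 0 := by
  unfold rhoT at h0
  unfold rhoTc
  have key := prob_mono hp (show sideEvent ER (RE ends a₁ a₂ T W_R ∩ connEvent ends r y) ⊆
      sideEvent ER (RE ends a₁ a₂ T W_R) from fun _ hω => hω.1)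
  rw [h0] at key
  exact le_antisymm key (prob_nonneg hp _)

omit [Fintype V] [DecidableEq V] [DecidablePred (· ∈ ES)] in
/-- `κ_r(y) = 0` when `ρ = 0`. -/
lemma kap_eq_zero (hp : IsProbVec p) (h0 : rhoR p ends a₁ a₂ ER = 0) (r y : V) :
    kap p ends a₁ a₂ ER r y = 0 := by
  unfold rhoR at h0
  unfold kap
  have key := prob_mono hp (show sideEvent ER (avoidAll ends a₂ {a₁} ∩ connEvent ends r y) ⊆
      sideEvent ER (avoidAll ends a₂ {a₁}) from fun _ hω => hω.1)
  rw [h0] at key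
  exact le_antisymm key (prob_nonneg hp _)

/-! ## The mark `o` on the `R`-side -/

omit [LinearOrder R] [IsStrictOrderedRing R] [DecidablePred (· ∈ ES)] in
/-- The `R`-factor of `SFg(γ)` sums to `Φ_γ(T)`. -/
lemma sum_phi_R (h : RootCut.IsRootCut ends a₁ a₂ ↑VR ↑VS ER ES) (T : Finset V) (o : V) (γ : R) :
    ∑ W_R ∈ VR.powerset, ((rhoTc p ends a₁ a₂ ER T W_R a₁ o - rhoTc p ends a₁ a₂ ER T W_R a₂ o) +
        s3 a₁ a₂ T * (γ * rhoT p ends a₁ a₂ ER T W_R -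
          (rhoTc p ends a₁ a₂ ER T W_R a₁ o + rhoTc p ends a₁ a₂ ER T W_R a₂ o))) =
      (kap p ends a₁ a₂ ER a₁ o - kap p ends a₁ a₂ ER a₂ o) +
        s3 a₁ a₂ T * (γ * rhoR p ends a₁ a₂ ER -
          (kap p ends a₁ a₂ ER a₁ o + kap p ends a₁ a₂ ER a₂ o)) := by
  rw [Finset.sum_add_distrib, Finset.sum_sub_distrib, ← Finset.mul_sum, Finset.sum_sub_distrib,
    ← Finset.mul_sum, Finset.sum_add_distrib, sum_rhoTc h T, sum_rhoTc h T, sum_rhoT h T]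

omit [LinearOrder R] [IsStrictOrderedRing R] in
/-- **`∑_W SFg(γ) W = ∑_T μ(T) · Φ_γ(T)`** for `o` on the `R`-side. -/
lemma sum_SFg_oR (h : RootCut.IsRootCut ends a₁ a₂ ↑VR ↑VS ER ES) {x : V} (hx : x ∈ VS) {o : V}
    (ho : o ∈ (↑VR : Set V) ∪ {a₁, a₂}) (γ : R) :
    ∑ W : Finset V, RootEdge.SFg p ends o a₁ a₂ x γ W =
      ∑ T ∈ (insert a₁ (insert a₂ VS)).powerset, muS p ends a₁ a₂ ES x T *
        ((kap p ends a₁ a₂ ER a₁ o - kap p ends a₁ a₂ ER a₂ o) +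
          s3 a₁ a₂ T * (γ * rhoR p ends a₁ a₂ ER -
            (kap p ends a₁ a₂ ER a₁ o + kap p ends a₁ a₂ ER a₂ o))) := by
  rw [sum_pairs_of_fibre h hx _ fun W hW => ?_]
  · refine Finset.sum_congr rfl fun T hT => ?_
    rw [Finset.mem_powerset] at hT
    rw [← sum_phi_R h T o γ, Finset.mul_sum]
    refine Finset.sum_congr rfl fun W_R hW => ?_
    rw [Finset.mem_powerset] at hW
    rw [RootEdge.SFg, Ssig_pair_R h hx hT hW ho, Su_pair_R h hx hT hW ho, mW_pair h hx hT hW,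
      s3_union_R h T hW]
    ring
  · obtain ⟨h1, h2, h3⟩ := masses_eq_zero_of_fibre_eq_empty (p := p) hW o
    rw [RootEdge.SFg, h1, h2, h3]
    ring

/-- **The ratio sum, `o` on the `R`-side**: `∑_W Sb·SFg(γ)/m_W = ∑_T (μ_{a₁}^b − μ_{a₂}^b)(T) · Φ_γ(T)`
— the `b`-factor `Sb/m_W` is constant along `W_R`, and the `o`-factor sums to the constants. -/
lemma sum_term_oR (hp : IsProbVec p) (h : RootCut.IsRootCut ends a₁ a₂ ↑VR ↑VS ER ES) {x : V}
    (hx : x ∈ VS) {b : V} (hb : b ∈ (↑VS : Set V) ∪ {a₁, a₂}) {o : V}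
    (ho : o ∈ (↑VR : Set V) ∪ {a₁, a₂}) (γ : R) :
    ∑ W : Finset V, Ssig p ends a₁ a₂ x b W * RootEdge.SFg p ends o a₁ a₂ x γ W /
        mW p ends a₁ a₂ x W =
      ∑ T ∈ (insert a₁ (insert a₂ VS)).powerset,
        (muSc p ends a₁ a₂ ES x a₁ b T - muSc p ends a₁ a₂ ES x a₂ b T) *
          ((kap p ends a₁ a₂ ER a₁ o - kap p ends a₁ a₂ ER a₂ o) +
            s3 a₁ a₂ T * (γ * rhoR p ends a₁ a₂ ER -
              (kap p ends a₁ a₂ ER a₁ o + kap p ends a₁ a₂ ER a₂ o))) := by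
  rw [sum_pairs_of_fibre h hx _ fun W hW => ?_]
  · refine Finset.sum_congr rfl fun T hT => ?_
    rw [Finset.mem_powerset] at hT
    rw [← sum_phi_R h T o γ, Finset.mul_sum]
    refine Finset.sum_congr rfl fun W_R hW => ?_
    rw [Finset.mem_powerset] at hW
    rw [RootEdge.SFg, Ssig_pair_S h hx hT hW hb, Ssig_pair_R h hx hT hW ho, Su_pair_R h hx hT hW ho,
      mW_pair h hx hT hW, s3_union_R h T hW]
    by_cases hμ : muS p ends a₁ a₂ ES x T = 0
    · rw [hμ, muSc_eq_zero hp hμ, muSc_eq_zero hp hμ]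
      simp
    by_cases hρ : rhoT p ends a₁ a₂ ER T W_R = 0
    · rw [hρ, rhoTc_eq_zero hp hρ, rhoTc_eq_zero hp hρ]
      simp
    · field_simp
  · rw [(masses_eq_zero_of_fibre_eq_empty (p := p) hW b).2.1, zero_mul, zero_div]

/-- **The `A`-ratio sum, `o` on the `R`-side**:
`∑_{W ∈ A} Su_b·Su_o/m_W = (κ_{a₁}(o) + κ_{a₂}(o)) · ∑_{T ⊆ VS} (μ_{a₁}^b + μ_{a₂}^b)(T)`. -/
lemma sum_termA_oR (hp : IsProbVec p) (h : RootCut.IsRootCut ends a₁ a₂ ↑VR ↑VS ER ES) {x : V}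
    (hx : x ∈ VS) {b : V} (hb : b ∈ (↑VS : Set V) ∪ {a₁, a₂}) {o : V}
    (ho : o ∈ (↑VR : Set V) ∪ {a₁, a₂}) :
    ∑ W ∈ fibresA a₁ a₂, Su p ends a₁ a₂ x b W * Su p ends a₁ a₂ x o W / mW p ends a₁ a₂ x W =
      (kap p ends a₁ a₂ ER a₁ o + kap p ends a₁ a₂ ER a₂ o) *
        ∑ T ∈ VS.powerset, (muSc p ends a₁ a₂ ES x a₁ b T + muSc p ends a₁ a₂ ES x a₂ b T) := by
  rw [sum_fibresA_eq h hx _ fun W hW => ?_, Finset.mul_sum]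
  · refine Finset.sum_congr rfl fun T hT => ?_
    rw [Finset.mem_powerset] at hT
    rw [Su_free_S h hx hT hb, Su_free_R h hx hT ho, mW_free h hx hT]
    by_cases hμ : muS p ends a₁ a₂ ES x T = 0
    · rw [hμ, muSc_eq_zero hp hμ, muSc_eq_zero hp hμ]
      simp
    by_cases hρ : rhoR p ends a₁ a₂ ER = 0
    · rw [hρ, kap_eq_zero hp hρ, kap_eq_zero hp hρ]
      simp
    · field_simp
  · rw [(masses_eq_zero_of_fibre_eq_empty (p := p) hW b).2.2, zero_mul, zero_div]

/-! ## The mark `b` on the `R`-side -/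

omit [LinearOrder R] [IsStrictOrderedRing R] in
/-- **`∑_W SFg(γ) W = ρ · ∑_T ψ_γ(T)`** for `o` on the `S`-side. -/
lemma sum_SFg_oS (h : RootCut.IsRootCut ends a₁ a₂ ↑VR ↑VS ER ES) {x : V} (hx : x ∈ VS) {o : V}
    (ho : o ∈ (↑VS : Set V) ∪ {a₁, a₂}) (γ : R) :
    ∑ W : Finset V, RootEdge.SFg p ends o a₁ a₂ x γ W =
      rhoR p ends a₁ a₂ ER * ∑ T ∈ (insert a₁ (insert a₂ VS)).powerset,
        ((muSc p ends a₁ a₂ ES x a₁ o T - muSc p ends a₁ a₂ ES x a₂ o T) +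
          s3 a₁ a₂ T * (γ * muS p ends a₁ a₂ ES x T -
            (muSc p ends a₁ a₂ ES x a₁ o T + muSc p ends a₁ a₂ ES x a₂ o T))) := by
  rw [sum_pairs_of_fibre h hx _ fun W hW => ?_, Finset.mul_sum]
  · refine Finset.sum_congr rfl fun T hT => ?_
    rw [Finset.mem_powerset] at hT
    rw [← sum_rhoT h T, Finset.sum_mul]
    refine Finset.sum_congr rfl fun W_R hW => ?_
    rw [Finset.mem_powerset] at hW
    rw [RootEdge.SFg, Ssig_pair_S h hx hT hW ho, Su_pair_S h hx hT hW ho, mW_pair h hx hT hW,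
      s3_union_R h T hW]
    ring
  · obtain ⟨h1, h2, h3⟩ := masses_eq_zero_of_fibre_eq_empty (p := p) hW o
    rw [RootEdge.SFg, h1, h2, h3]
    ring

/-- **The ratio sum, `b` on the `R`-side**:
`∑_W Sb·SFg(γ)/m_W = (κ_{a₁}(b) − κ_{a₂}(b)) · ∑_T ψ_γ(T)` — for EVERY centring `γ`. -/
lemma sum_term_bR (hp : IsProbVec p) (h : RootCut.IsRootCut ends a₁ a₂ ↑VR ↑VS ER ES) {x : V}
    (hx : x ∈ VS) {b : V} (hb : b ∈ (↑VR : Set V) ∪ {a₁, a₂}) {o : V}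
    (ho : o ∈ (↑VS : Set V) ∪ {a₁, a₂}) (γ : R) :
    ∑ W : Finset V, Ssig p ends a₁ a₂ x b W * RootEdge.SFg p ends o a₁ a₂ x γ W /
        mW p ends a₁ a₂ x W =
      (kap p ends a₁ a₂ ER a₁ b - kap p ends a₁ a₂ ER a₂ b) *
        ∑ T ∈ (insert a₁ (insert a₂ VS)).powerset,
          ((muSc p ends a₁ a₂ ES x a₁ o T - muSc p ends a₁ a₂ ES x a₂ o T) +
            s3 a₁ a₂ T * (γ * muS p ends a₁ a₂ ES x T -
              (muSc p ends a₁ a₂ ES x a₁ o T + muSc p ends a₁ a₂ ES x a₂ o T))) := by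
  rw [sum_pairs_of_fibre h hx _ fun W hW => ?_, Finset.mul_sum]
  · refine Finset.sum_congr rfl fun T hT => ?_
    rw [Finset.mem_powerset] at hT
    rw [← sum_rhoTc h T a₁ b, ← sum_rhoTc h T a₂ b, ← Finset.sum_sub_distrib, Finset.sum_mul]
    refine Finset.sum_congr rfl fun W_R hW => ?_
    rw [Finset.mem_powerset] at hW
    rw [RootEdge.SFg, Ssig_pair_R h hx hT hW hb, Ssig_pair_S h hx hT hW ho, Su_pair_S h hx hT hW ho,
      mW_pair h hx hT hW, s3_union_R h T hW]
    by_cases hμ : muS p ends a₁ a₂ ES x T = 0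
    · rw [hμ, muSc_eq_zero hp hμ, muSc_eq_zero hp hμ]
      simp
    by_cases hρ : rhoT p ends a₁ a₂ ER T W_R = 0
    · rw [hρ, rhoTc_eq_zero hp hρ, rhoTc_eq_zero hp hρ]
      simp
    · field_simp
  · rw [(masses_eq_zero_of_fibre_eq_empty (p := p) hW b).2.1, zero_mul, zero_div]

/-- **The `A`-ratio sum, `b` on the `R`-side**:
`∑_{W ∈ A} Su_b·Su_o/m_W = (κ_{a₁}(b) + κ_{a₂}(b)) · ∑_{T ⊆ VS} (μ_{a₁}^o + μ_{a₂}^o)(T)`. -/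
lemma sum_termA_bR (hp : IsProbVec p) (h : RootCut.IsRootCut ends a₁ a₂ ↑VR ↑VS ER ES) {x : V}
    (hx : x ∈ VS) {b : V} (hb : b ∈ (↑VR : Set V) ∪ {a₁, a₂}) {o : V}
    (ho : o ∈ (↑VS : Set V) ∪ {a₁, a₂}) :
    ∑ W ∈ fibresA a₁ a₂, Su p ends a₁ a₂ x b W * Su p ends a₁ a₂ x o W / mW p ends a₁ a₂ x W =
      (kap p ends a₁ a₂ ER a₁ b + kap p ends a₁ a₂ ER a₂ b) *
        ∑ T ∈ VS.powerset, (muSc p ends a₁ a₂ ES x a₁ o T + muSc p ends a₁ a₂ ES x a₂ o T) := by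
  rw [sum_fibresA_eq h hx _ fun W hW => ?_, Finset.mul_sum]
  · refine Finset.sum_congr rfl fun T hT => ?_
    rw [Finset.mem_powerset] at hT
    rw [Su_free_R h hx hT hb, Su_free_S h hx hT ho, mW_free h hx hT]
    by_cases hμ : muS p ends a₁ a₂ ES x T = 0
    · rw [hμ, muSc_eq_zero hp hμ, muSc_eq_zero hp hμ]
      simp
    by_cases hρ : rhoR p ends a₁ a₂ ER = 0
    · rw [hρ, kap_eq_zero hp hρ, kap_eq_zero hp hρ]
      simp
    · field_simp
  · rw [(masses_eq_zero_of_fibre_eq_empty (p := p) hW b).2.2, zero_mul, zero_div]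

end Ratio

end RootShield

end A3Fibre

end CovForm

end Summit.Ventures.PercRepro2
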